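import Mathlib
import HarnessLib
import Summits.AtomisticToContinuum.FouriersLaw.Theses.JunctionLocality
import Literature.MathematicalPhysics.KineticTheory.LangevinChainTransitionDensity
import Literature.MathematicalPhysics.KineticTheory.LangevinChainConfined
import Literature.Analysis.Hypoelliptic.HormanderProof
import Literature.Analysis.Distribution.BracketSpanRescale
import Literature.Analysis.Distribution.FieldIntegrationByParts

/-!
# The plain chain's equilibrium forward field, I: the generator as a hypoelliptic operator

Helper file 1 (`--supports` stmt-AtomisticToContinuum-11748) for stub `stub_plainForwardField` of
line `floating-probe-bypass-laplacian` (crux `JunctionLocality.SuperadditiveResistance`): existence of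
a classical `C² ∩ L²(μ_T)` solution of the Poisson problem `L g = −(p_0² − T)` for the generator
`L = OscillatorChain.generator L T T` of the Langevin chain at equal bath temperatures.

This part is the DISTRIBUTION THEORY of the generator `L = X_L² + X_R² + Y` itself (the tree's
`LangevinChainHormander.lean` treats its formal adjoint `L* = X_L² + X_R² − Y + 2γ`):

* `hormanderTranspose_generatorFamily` — the formal transpose of `L` in Hörmander's form
  `(Y, X_L, X_R; c = 0)` is `ᵗL φ = L φ − 2 Y·∇φ + 2γ φ`, and `revGenerator_eq` — this is
  `L̂ φ + 2γ φ` with `L̂` the generator of the time-REVERSED Langevin equation (drift `−Y`), the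
  operator produced by the kernel-level backward equation of `ConfinedBackward.lean`;
* `isBracketGenerating_generatorFamily` — Hörmander's bracket condition for `(Y, X_L, X_R)`
  (from CEHR Prop. 4.1 for `(−Y, X_L, X_R)`, `isBracketGenerating_hormanderFamily`, by sign-rescaling);
* `exists_smooth_ae_eq_of_weak_poisson` — HYPOELLIPTIC REGULARITY for `L`: a locally integrable
  distribution solution `u` of `L u = f` (`∫ u ᵗLφ = ∫ f φ` for `φ ∈ C_c^∞`, `f` smooth) agrees a.e.
  with a smooth function (Hörmander's Theorem 1.1, PROVED in the tree as
  `Literature.Analysis.Hypoelliptic.hormander1967_thm11_proof`);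
* `integral_hormanderOp_mul'` (integration by parts with the TEST function compactly supported) and
  `generator_eq_of_weak_poisson` — a smooth distribution solution is a classical solution.

References: L. Hörmander, Acta Math. 119 (1967), Thm 1.1; Cuneo–Eckmann–Hairer–Rey-Bellet, EJP 23
(2018) no. 55, §3.1 and Prop. 4.1.
-/

noncomputable section

open MeasureTheory Filter Topology Set
open scoped ContDiff
open Literature.MathematicalPhysics.KineticTheory.HeatConduction
open Literature.MathematicalPhysics.KineticTheory (sdeGenerator sdeGenerator_def)
open Literature.Analysis.Distribution Distributions

namespace Summit.AtomisticToContinuum.FouriersLaw.Theorems.SuperadditiveResistance.PlainForwardField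

variable {N : ℕ}

/-! ## The formal transpose of the generator -/

section Transpose

variable (P : OscillatorChain)

/-- **The generator of the reversed Langevin equation through the generator**: for `f ∈ C²`,
`L̂ f = L f − 2 Y·∇f` (`L̂ = sdeGenerator (−Y) v_L v_R`, `L = sdeGenerator Y v_L v_R`; the
second-order parts agree). [folklore] -/
theorem revGenerator_eq (hN : 0 < N) {T_L T_R : ℝ} (hL : 0 ≤ P.γ * T_L) (hR : 0 ≤ P.γ * T_R)
    {f : PhaseSpace N → ℝ} (hf : ContDiff ℝ 2 f) (x : PhaseSpace N) :
    sdeGenerator (fun y => -P.drift N y) (P.bathVecL N T_L) (P.bathVecR N T_R) f x =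
      P.generator N T_L T_R f x - 2 * fderiv ℝ f x (P.drift N x) := by
  rw [← P.sdeGenerator_drift_eq_generator hN hL hR hf, sdeGenerator_def, sdeGenerator_def, map_neg]
  ring

/-- `div(−Y) = 2γ` (`N ≥ 1`). [folklore] -/
theorem fieldDiv_adjointDrift (hU : ContDiff ℝ ∞ P.U) (hV : ContDiff ℝ ∞ P.V) (hN : 0 < N)
    (x : PhaseSpace N) : fieldDiv (P.adjointDrift N) x = 2 * P.γ := by
  have h1 : P.adjointDrift N = fun y => -P.drift N y := rfl
  rw [fieldDiv, h1, fderiv_fun_neg]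
  simp only [ContinuousLinearMap.toLinearMap_neg, map_neg]
  rw [show LinearMap.trace ℝ _ (fderiv ℝ (P.drift N) x : PhaseSpace N →ₗ[ℝ] PhaseSpace N) =
    fieldDiv (P.drift N) x from rfl, P.fieldDiv_drift hU hV hN]
  ring

/-- **The formal transpose of the generator in Hörmander's form** `L = X_L² + X_R² + Y`
(`X_b = √(γT_b) ∂_{p_b}`, drift `Y`, `c = 0`): `ᵗL φ = L φ − 2 Y·∇φ + 2γ φ` for smooth `φ`
(`ᵗY = −Y − div Y = −Y + 2γ`; compare `hormanderTranspose_eq_generator`: `ᵗ(L*) = L`).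
[cite: CuneoEckmannHairerReyBellet2018, §3.1] -/
theorem hormanderTranspose_generatorFamily (hU : ContDiff ℝ ∞ P.U) (hV : ContDiff ℝ ∞ P.V)
    (hN : 0 < N) {T_L T_R : ℝ} (hL : 0 ≤ P.γ * T_L) (hR : 0 ≤ P.γ * T_R)
    {f : PhaseSpace N → ℝ} (hf : ContDiff ℝ ∞ f) (x : PhaseSpace N) :
    hormanderTranspose (P.drift N) (P.bathField hN T_L T_R) (fun _ => 0) f x =
      P.generator N T_L T_R f x - 2 * fderiv ℝ f x (P.drift N x) + 2 * P.γ * f x := by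
  rw [← P.hormanderTranspose_eq_generator hU hV hN hL hR hf]
  simp only [hormanderTranspose]
  have hdiv : fieldDiv (P.drift N) x = -(2 * P.γ) := P.fieldDiv_drift hU hV hN x
  have hdiv' : fieldDiv (P.adjointDrift N) x = 2 * P.γ := fieldDiv_adjointDrift P hU hV hN x
  have had : P.adjointDrift N x = -P.drift N x := rfl
  simp only [fieldTranspose, fieldDeriv, hdiv, hdiv', had, map_neg]
  ring

/-- **`ᵗL = L̂ + 2γ`**: the formal transpose of the generator is the generator of the reversed
Langevin equation plus the constant `2γ = −div Y` (smooth `φ`). [cite: CuneoEckmannHairerReyBellet2018, §3.1] -/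
theorem hormanderTranspose_generatorFamily_eq_revGenerator (hU : ContDiff ℝ ∞ P.U)
    (hV : ContDiff ℝ ∞ P.V) (hN : 0 < N) {T_L T_R : ℝ} (hL : 0 ≤ P.γ * T_L) (hR : 0 ≤ P.γ * T_R)
    {f : PhaseSpace N → ℝ} (hf : ContDiff ℝ ∞ f) (x : PhaseSpace N) :
    hormanderTranspose (P.drift N) (P.bathField hN T_L T_R) (fun _ => 0) f x =
      sdeGenerator (fun y => -P.drift N y) (P.bathVecL N T_L) (P.bathVecR N T_R) f x +
        2 * P.γ * f x := by
  rw [hormanderTranspose_generatorFamily P hU hV hN hL hR hf,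
    revGenerator_eq P hN hL hR (hf.of_le (by norm_cast))]

/-! ## The bracket condition for `(Y, X_L, X_R)` -/

/-- **Hörmander's bracket condition for the generator's own family `(Y, X_L, X_R)`** (smooth
potentials, `V″ ≠ 0`, `γ T_L > 0`): the family differs from `(−Y, X_L, X_R)` of
`isBracketGenerating_hormanderFamily` (CEHR Prop. 4.1) by the sign of the drift only, and the
bracket condition is invariant under non-zero constant rescaling of the fields.
[cite: CuneoEckmannHairerReyBellet2018, Prop 4.1] -/
theorem isBracketGenerating_generatorFamily (hU : ContDiff ℝ ∞ P.U) (hV : ContDiff ℝ ∞ P.V)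
    (hN : 0 < N) {T_L T_R : ℝ} (hγL : 0 < P.γ * T_L) (hV2 : ∀ r, deriv (deriv P.V) r ≠ 0) :
    IsBracketGenerating (fun o : Option (Fin 2) => o.elim (P.drift N) (P.bathField hN T_L T_R))
      univ := by
  have hX : ∀ o : Option (Fin 2), ContDiff ℝ ∞ (P.hormanderFamily hN T_L T_R o) := by
    rintro (_ | b)
    · exact P.contDiff_adjointDrift hU hV N
    · exact contDiff_const
  have hX' : ∀ o : Option (Fin 2),
      (fun o : Option (Fin 2) => o.elim (P.drift N) (P.bathField hN T_L T_R)) o =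
        (fun o : Option (Fin 2) => o.elim (-1 : ℝ) (fun _ => 1)) o • P.hormanderFamily hN T_L T_R o := by
    rintro (_ | b)
    · funext y
      simp [OscillatorChain.hormanderFamily, OscillatorChain.adjointDrift]
    · funext y
      simp [OscillatorChain.hormanderFamily]
  have hc : ∀ o : Option (Fin 2), (fun o : Option (Fin 2) => o.elim (-1 : ℝ) (fun _ => 1)) o ≠ 0 := by
    rintro (_ | b) <;> simp
  exact (isBracketGenerating_iff_of_eq_smul hX hX' hc univ).2
    (P.isBracketGenerating_hormanderFamily hN T_L T_R hU hV hγL hV2)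

end Transpose

/-! ## Integration by parts with the test function compactly supported -/

section IBP

variable {E : Type*} [NormedAddCommGroup E] [NormedSpace ℝ E] [FiniteDimensional ℝ E]
  [MeasurableSpace E] [BorelSpace E] {μ : Measure E} [μ.IsAddHaarMeasure] {ι : Type*} [Fintype ι]

omit [FiniteDimensional ℝ E] [MeasurableSpace E] [BorelSpace E] in
/-- `ᵗX g` is compactly supported if `g` is. [folklore] -/
theorem hasCompactSupport_fieldTranspose (X : E → E) {g : E → ℝ} (hgc : HasCompactSupport g) :
    HasCompactSupport (fieldTranspose X g) :=
  hgc.mono' ((subset_tsupport _).trans (tsupport_fieldTranspose_subset X g))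

/-- **`∫ (Pf) g dμ = ∫ f (ᵗPg) dμ` with the TEST function `g` compactly supported** (`f` merely
smooth): the companion of `integral_hormanderOp_mul` needed to read a smooth distribution
solution of `P u = h` as a classical one. [cite: Hormander1967, p. 152] -/
theorem integral_hormanderOp_mul' {X₀ : E → E} {X : ι → E → E} {c f g : E → ℝ}
    (hX₀ : ContDiff ℝ ∞ X₀) (hX : ∀ j, ContDiff ℝ ∞ (X j)) (hc : ContDiff ℝ ∞ c)
    (hf : ContDiff ℝ ∞ f) (hg : ContDiff ℝ ∞ g) (hgc : HasCompactSupport g) :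
    ∫ x, hormanderOp X₀ X c f x * g x ∂μ = ∫ x, f x * hormanderTranspose X₀ X c g x ∂μ := by
  have h1 : ∀ {Z : E → E}, ContDiff ℝ ∞ Z → ContDiff ℝ 1 Z := fun h => h.of_le (by exact_mod_cast le_top)
  have hone : ∀ {k : E → ℝ}, ContDiff ℝ ∞ k → ContDiff ℝ 1 k := fun h => h.of_le (by exact_mod_cast le_top)
  -- second-order terms
  have hsq : ∀ j, ∫ x, fieldDeriv (X j) (fieldDeriv (X j) f) x * g x ∂μ =
      ∫ x, f x * fieldTranspose (X j) (fieldTranspose (X j) g) x ∂μ := by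
    intro j
    have hXf : ContDiff ℝ ∞ (fieldDeriv (X j) f) := contDiff_fieldDeriv (hX j) hf
    have hXg : ContDiff ℝ ∞ (fieldTranspose (X j) g) := contDiff_fieldTranspose (hX j) hg
    rw [integral_fieldDeriv_mul' (h1 (hX j)) (hone hXf) (hone hg) hgc,
      integral_fieldDeriv_mul' (h1 (hX j)) (hone hf) (hone hXg)
        (hasCompactSupport_fieldTranspose (X j) hgc)]
  -- integrability
  have iP : ∀ j, Integrable (fun x => fieldDeriv (X j) (fieldDeriv (X j) f) x * g x) μ := fun j =>
    ((contDiff_fieldDeriv (hX j) (contDiff_fieldDeriv (hX j) hf)).continuous.mul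
      hg.continuous).integrable_of_hasCompactSupport hgc.mul_left
  have i0 : Integrable (fun x => fieldDeriv X₀ f x * g x) μ :=
    ((contDiff_fieldDeriv hX₀ hf).continuous.mul hg.continuous).integrable_of_hasCompactSupport
      hgc.mul_left
  have ic : Integrable (fun x => c x * f x * g x) μ :=
    ((hc.continuous.mul hf.continuous).mul hg.continuous).integrable_of_hasCompactSupport
      hgc.mul_left
  have iP' : ∀ j, Integrable (fun x => f x * fieldTranspose (X j) (fieldTranspose (X j) g) x) μ :=
    fun j => (hf.continuous.mul (contDiff_fieldTranspose (hX j)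
      (contDiff_fieldTranspose (hX j) hg)).continuous).integrable_of_hasCompactSupport
      (hasCompactSupport_fieldTranspose (X j) (hasCompactSupport_fieldTranspose (X j) hgc)).mul_left
  have i0' : Integrable (fun x => f x * fieldTranspose X₀ g x) μ :=
    (hf.continuous.mul (contDiff_fieldTranspose hX₀ hg).continuous).integrable_of_hasCompactSupport
      (hasCompactSupport_fieldTranspose X₀ hgc).mul_left
  have ic' : Integrable (fun x => f x * (c x * g x)) μ :=
    (hf.continuous.mul (hc.continuous.mul hg.continuous)).integrable_of_hasCompactSupport
      hgc.mul_left.mul_left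
  -- expand both sides
  have eL : (fun x => hormanderOp X₀ X c f x * g x) = fun x =>
      (∑ j, fieldDeriv (X j) (fieldDeriv (X j) f) x * g x) + fieldDeriv X₀ f x * g x +
        c x * f x * g x := by
    ext x; simp only [hormanderOp, Finset.sum_mul, add_mul]
  have eR : (fun x => f x * hormanderTranspose X₀ X c g x) = fun x =>
      (∑ j, f x * fieldTranspose (X j) (fieldTranspose (X j) g) x) +
        f x * fieldTranspose X₀ g x + f x * (c x * g x) := by
    ext x; simp only [hormanderTranspose, Finset.mul_sum, mul_add]
  have iS : Integrable (fun x => ∑ j, fieldDeriv (X j) (fieldDeriv (X j) f) x * g x) μ :=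
    integrable_finsetSum _ fun j _ => iP j
  have iS0 : Integrable (fun x => (∑ j, fieldDeriv (X j) (fieldDeriv (X j) f) x * g x) +
      fieldDeriv X₀ f x * g x) μ := iS.add i0
  have iS' : Integrable (fun x => ∑ j, f x * fieldTranspose (X j) (fieldTranspose (X j) g) x) μ :=
    integrable_finsetSum _ fun j _ => iP' j
  have iS0' : Integrable (fun x => (∑ j, f x * fieldTranspose (X j) (fieldTranspose (X j) g) x) +
      f x * fieldTranspose X₀ g x) μ := iS'.add i0'
  rw [eL, eR, integral_add iS0 ic, integral_add iS i0, integral_finsetSum _ fun j _ => iP j,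
    integral_add iS0' ic', integral_add iS' i0', integral_finsetSum _ fun j _ => iP' j]
  simp only [hsq, integral_fieldDeriv_mul' (h1 hX₀) (hone hf) (hone hg) hgc]
  congr 1
  exact integral_congr_ae (Eventually.of_forall fun x => by ring)

end IBP

/-! ## Hypoelliptic regularity and classical solutions for the generator of the pinned chain -/

section Pinned

variable {ω₂ lam β : ℝ}

/-- **Hypoelliptic regularity for the Poisson equation of the generator** (Hörmander's Theorem 1.1,
PROVED in the tree, with the bracket condition `isBracketGenerating_generatorFamily`): for the
pinned chain with `γ, T > 0`, `β ≥ 0`, `L ≥ 1`, a locally integrable `u` and a smooth `f` with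
`∫ u (ᵗL φ) dx = ∫ f φ dx` for all `φ ∈ C_c^∞` (`L u = f` in `𝓓'`) — `u` agrees a.e. with a smooth
function. [cite: Hormander1967, Thm 1.1] -/
theorem exists_smooth_ae_eq_of_weak_poisson (hβ : 0 ≤ β) {γ : ℝ} (hγ : 0 < γ) {L : ℕ} (hL : 0 < L)
    {T : ℝ} (hT : 0 < T) {u f : PhaseSpace L → ℝ} (hu : LocallyIntegrable u volume)
    (hf : ContDiff ℝ ∞ f)
    (hweak : ∀ φ : PhaseSpace L → ℝ, ContDiff ℝ ∞ φ → HasCompactSupport φ →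
      ∫ x, u x * hormanderTranspose ((pinnedChain ω₂ lam β γ).drift L)
        ((pinnedChain ω₂ lam β γ).bathField hL T T) (fun _ => 0) φ x = ∫ x, f x * φ x) :
    ∃ g : PhaseSpace L → ℝ, ContDiff ℝ ∞ g ∧ u =ᵐ[volume] g := by
  haveI := isAddHaarMeasure_volume_phaseSpace L
  set P := pinnedChain ω₂ lam β γ with hP
  have hU : ContDiff ℝ ∞ P.U := pinnedChain_contDiff_U ω₂ lam β γ
  have hV : ContDiff ℝ ∞ P.V := pinnedChain_contDiff_V ω₂ lam β γ
  have hγ' : P.γ = γ := rfl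
  have hγT : 0 < P.γ * T := by rw [hγ']; positivity
  have hV2 : ∀ r, deriv (deriv P.V) r ≠ 0 := fun r => by
    rw [hP, pinnedChain_deriv_deriv_V]; positivity
  have huloc : LocallyIntegrableOn u ((⊤ : TopologicalSpace.Opens (PhaseSpace L)) : Set (PhaseSpace L))
      volume := hu.locallyIntegrableOn _
  let U : 𝓓'((⊤ : TopologicalSpace.Opens (PhaseSpace L)), ℝ) :=
    (TestFunction.integralAgainstBilinCLM (ContinuousLinearMap.mul ℝ ℝ) volume u :
      𝓓((⊤ : TopologicalSpace.Opens (PhaseSpace L)), ℝ) →L[ℝ] ℝ)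
  have hUφ : ∀ φ : 𝓓((⊤ : TopologicalSpace.Opens (PhaseSpace L)), ℝ), U φ = ∫ x, φ x * u x := by
    intro φ
    change TestFunction.integralAgainstBilinCLM (ContinuousLinearMap.mul ℝ ℝ) volume u φ = _
    rw [TestFunction.integralAgainstBilinCLM_eq_integral huloc]
    simp
  have hyp := Literature.Analysis.Hypoelliptic.hormander1967_thm11_proof (PhaseSpace L) volume (Fin 2) ⊤
    (P.drift L) (P.bathField hL T T) (fun _ => 0) (P.contDiff_drift hU hV L)
    (fun _ => contDiff_const) contDiff_const
    (isBracketGenerating_generatorFamily P hU hV hL hγT hV2)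
  have himg : ImageIsSmoothOn U (hormanderTranspose (P.drift L) (P.bathField hL T T)
      (fun _ => 0)) volume Set.univ := by
    refine ⟨f, hf.contDiffOn, fun φ ψ _ hψ => ?_⟩
    rw [hUφ]
    have h1 : (fun x => ψ x) = hormanderTranspose (P.drift L) (P.bathField hL T T)
        (fun _ => 0) φ := hψ
    have h2 := hweak φ φ.contDiff φ.hasCompactSupport
    rw [show (∫ x, ψ x * u x) = ∫ x, (fun x => ψ x) x * u x from rfl, h1]
    calc ∫ x, hormanderTranspose (P.drift L) (P.bathField hL T T) (fun _ => 0) φ x * u x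
        = ∫ x, u x * hormanderTranspose (P.drift L) (P.bathField hL T T) (fun _ => 0) φ x :=
          integral_congr_ae (ae_of_all _ fun x => mul_comm _ _)
      _ = ∫ x, f x * φ x := h2
  obtain ⟨g, hg, hgint⟩ := hyp U Set.univ isOpen_univ (Set.subset_univ _) himg
  refine ⟨g, contDiffOn_univ.mp hg, ?_⟩
  have hgloc : LocallyIntegrable g volume := (contDiffOn_univ.mp hg).continuous.locallyIntegrable
  refine ae_eq_of_integral_contDiff_smul_eq hu hgloc fun φ hφ hφc => ?_
  let Φ : 𝓓((⊤ : TopologicalSpace.Opens (PhaseSpace L)), ℝ) := ⟨φ, hφ, hφc, by simp⟩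
  have e2 := hgint Φ (Set.subset_univ _)
  simp only [smul_eq_mul]
  calc ∫ x, φ x * u x = U Φ := (hUφ Φ).symm
    _ = ∫ x, g x * Φ x := e2
    _ = ∫ x, φ x * g x := integral_congr_ae (ae_of_all _ fun x => by show g x * φ x = φ x * g x; ring)

/-- **A smooth distribution solution of `L g = f` is a classical solution** (any chain with
smooth potentials, `N ≥ 1`, `γT_b ≥ 0`): if `g, f` are smooth resp. continuous and
`∫ g (ᵗL φ) dx = ∫ f φ dx` for all `φ ∈ C_c^∞`, then `L g = f` everywhere (integration by parts,
the fundamental lemma of the calculus of variations, continuity). [folklore] -/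
theorem generator_eq_of_weak_poisson (P : OscillatorChain) (hU : ContDiff ℝ ∞ P.U)
    (hV : ContDiff ℝ ∞ P.V) (hN : 0 < N) {T_L T_R : ℝ} (hL : 0 ≤ P.γ * T_L) (hR : 0 ≤ P.γ * T_R)
    {g f : PhaseSpace N → ℝ} (hg : ContDiff ℝ ∞ g) (hf : Continuous f)
    (hweak : ∀ φ : PhaseSpace N → ℝ, ContDiff ℝ ∞ φ → HasCompactSupport φ →
      ∫ x, g x * hormanderTranspose (P.drift N) (P.bathField hN T_L T_R) (fun _ => 0) φ x =
        ∫ x, f x * φ x) (x : PhaseSpace N) :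
    P.generator N T_L T_R g x = f x := by
  haveI := isAddHaarMeasure_volume_phaseSpace N
  have hLg : Continuous (P.generator N T_L T_R g) :=
    P.continuous_generator (hU.of_le (by exact_mod_cast le_top)) (hV.of_le (by exact_mod_cast le_top))
      N T_L T_R (hg.of_le (by norm_cast))
  have hdiff : Continuous fun y => P.generator N T_L T_R g y - f y := hLg.sub hf
  have hae : ∀ᵐ y ∂(volume : Measure (PhaseSpace N)), P.generator N T_L T_R g y - f y = 0 := by
    refine ae_eq_zero_of_integral_contDiff_smul_eq_zero hdiff.locallyIntegrable fun φ hφ hφc => ?_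
    have hi1 : Integrable (fun y => φ y * P.generator N T_L T_R g y) volume :=
      (hφ.continuous.mul hLg).integrable_of_hasCompactSupport hφc.mul_right
    have hi2 : Integrable (fun y => φ y * f y) volume :=
      (hφ.continuous.mul hf).integrable_of_hasCompactSupport hφc.mul_right
    simp only [smul_eq_mul, mul_sub]
    rw [integral_sub hi1 hi2, sub_eq_zero]
    have h1 : ∫ y, φ y * P.generator N T_L T_R g y = ∫ y, g y *
        hormanderTranspose (P.drift N) (P.bathField hN T_L T_R) (fun _ => 0) φ y := by
      rw [← integral_hormanderOp_mul' (X := P.bathField hN T_L T_R) (P.contDiff_drift hU hV N) (fun _ => contDiff_const)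
        contDiff_const hg hφ hφc]
      refine integral_congr_ae (ae_of_all _ fun y => ?_)
      show φ y * P.generator N T_L T_R g y = hormanderOp (P.drift N) (P.bathField hN T_L T_R)
        (fun _ => 0) g y * φ y
      rw [P.generator_eq_hormanderOp hN hL hR hg y, mul_comm]
    rw [h1, hweak φ hφ hφc]
    exact integral_congr_ae (ae_of_all _ fun y => mul_comm _ _)
  have heq : (fun y => P.generator N T_L T_R g y - f y) = fun _ => 0 :=
    (Continuous.ae_eq_iff_eq volume hdiff continuous_const).1 hae
  have := congrFun heq x
  simpa [sub_eq_zero] using this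

end Pinned

/-! ## Registered helper stub -/

/-- **Registered helper stub of this file** (`helper_plainForwardFieldHypoelliptic`): hypoelliptic
regularity for the Poisson equation `L u = f` of the pinned chain's generator, in the sense of
distributions (= `exists_smooth_ae_eq_of_weak_poisson`). [cite: Hormander1967, Thm 1.1] -/
theorem helper_plainForwardFieldHypoelliptic : ∀ {ω₂ lam β : ℝ}, 0 ≤ β → ∀ {γ : ℝ}, 0 < γ → ∀ {L : ℕ} (hL : 0 < L) {T : ℝ}, 0 < T → ∀ {u f : PhaseSpace L → ℝ}, LocallyIntegrable u volume → ContDiff ℝ ∞ f → (∀ φ : PhaseSpace L → ℝ, ContDiff ℝ ∞ φ → HasCompactSupport φ → ∫ x, u x * hormanderTranspose ((pinnedChain ω₂ lam β γ).drift L) ((pinnedChain ω₂ lam β γ).bathField hL T T) (fun _ => 0) φ x = ∫ x, f x * φ x) → ∃ g : PhaseSpace L → ℝ, ContDiff ℝ ∞ g ∧ u =ᵐ[volume] g :=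
  fun hβ _ hγ _ hL _ hT _ _ hu hf hweak => exists_smooth_ae_eq_of_weak_poisson hβ hγ hL hT hu hf hweak

end Summit.AtomisticToContinuum.FouriersLaw.Theorems.SuperadditiveResistance.PlainForwardField

end
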